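import Summits.NavierStokesRegularity.NavierStokesRegularity.Theorems.ScalingDefectPeepholeDoorTubeWindow
import Summits.NavierStokesRegularity.NavierStokesRegularity.Theorems.ScalingDefectPeepholeDoorSlicePressure
import Summits.NavierStokesRegularity.NavierStokesRegularity.Theorems.ScalingDefectPeepholeDoorDoor

/-!
# ScalingDefectPeepholeDoorTube — door S30 «ScalingDefectPeepholeDoor» v2 (nsreg-p1 g24 ROUND-28 v2 6cf1a9889313ec10; texts
# `Theorems/ScalingDefectPeepholeDoorDefs.lean` = `r28/Sketch30v2.lean` 325dd7ac74e245e5): plate P2 = K1ω BY NAME, and the DOOR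

* `vortexDefectTubeBound_holds : VortexDefectTubeBound` — K1ω, the vortex-defect tube bound: parts T1 (`…TubeCalculus`, SCV on the
  tube), T2a/T2b (`…TubeResidual`, `…TubeDefect`: the defect's extension from the window field's), T4 (`…TubeAssembly`), T3
  (`…TubeWindow`: Bradshaw–Grujić–Kukavica with the bound of its scheme at unit scale on the zoomed-shifted Pineau–Vicol-class
  solution) — this seat — and the scaled slice pressure bound `scaledSlicePressure_holds` (`…SlicePressure`, ns-s29-p2 g2: the
  exponent-2 twin of the tree's Pineau–Vicol §9 slice device + the sharp Type-I `L⁴` radial bound).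
* `targetVortexDefectPeephole_holds : TargetVortexDefectPeephole` — DOOR S30 (v2) BY NAME, through ns-s29-p2's composition
  `targetVortexDefectPeephole_of_tubeBound` (`…Door`: K2 `tubePropagation_holds`, LEG Cω `quietVortexCoreRigidity_holds`, the criterion
  `regularOfQuietCoreVorticity_holds`, the frame `frameTransferS30_holds`).

HONEST FRAME: `TargetVortexDefectPeephole` is a regularity CRITERION about a HYPOTHETICAL local Type-I blow-up — «a Type-I singularity
cannot look, through any ball peephole of the similarity window at any single late instant, like a slice of a self-similar VORTICITY
profile to order ε(ν, M, y₀, r)» — an instrument on the Type-I half of item 0056 `NoTypeII`, which stays OPEN; nothing here proves or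
claims Navier–Stokes regularity (Clay (A)).
-/

noncomputable section

set_option linter.dupNamespace false

namespace Summit.NavierStokesRegularity.NavierStokesRegularity.Theorems.ScalingDefectPeepholeDoor

/-- **K1ω · `VortexDefectTubeBound` holds** (door S30 v2, plate P2): the vorticity defect of the window field of a Pineau–Vicol-class
solution extends, at every late time, to a holomorphic map on the local complex tube `localComplexTube 0 A δ(C_u, A)` bounded by
`K(C_u, A)` — from the window-field extension (BGK 2015 Thm 2.3 with the bound of its scheme, tree
`bradshawGrujicKukavica2015_local_analyticity_radius_supBound`, on a late parabolic window at unit scale), three rounds of Cauchy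
estimates + real-slice agreement on the tube, and the scaled slice pressure bound. -/
theorem vortexDefectTubeBound_holds : VortexDefectTubeBound :=
  vortexDefectTubeBound_of_scaledSlicePressure scaledSlicePressure_holds

/-- **DOOR S30 (v2) BY NAME: `TargetVortexDefectPeephole` holds** — for every viscosity `ν > 0`, Type-I constant `M` and ball peephole
`B_r(y₀)` of the similarity window there is `ε > 0` and, for every class `(T, ρ, E₀)`, one lateness `t⋆ < T` such that a classical
Leray–Hopf solution with local Type I(`M`) at `(x₀, T)` whose vorticity defect is `≤ ε` on the peephole at ONE time `t̄ ∈ (t⋆, T)` is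
backward-bounded at `(x₀, T)`.  A CRITERION inside a hypothetical local Type-I blow-up; 0056 and NS regularity remain OPEN. -/
theorem targetVortexDefectPeephole_holds : TargetVortexDefectPeephole :=
  targetVortexDefectPeephole_of_tubeBound vortexDefectTubeBound_holds

end Summit.NavierStokesRegularity.NavierStokesRegularity.Theorems.ScalingDefectPeepholeDoor

end
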